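/-
Copyright (c) 2026 the pub-hodgecm-mathlib formalisation cell (harness21).  Prover seat hodgecm-mathlib-K2E5-p12 (g2), Track B «K2-LIT» ∕ h413, deal (D19) of
K2E3-plan (g2) under the §L line lead K2E3-p12 (g3): FILE A (generic algebra) of `Theorems/K2E3U2DiscrInvFourthRootLocallyIntegrable.lean`.  2026-09-04.
-/
import Summits.HodgeConjecture.HodgeConjecture.Theorems.K2E3LieUnitaryDefs      -- ★ defs leaf (K2-defs1): `lieOfForm`, `mem_lieOfForm_iff`
import Mathlib.LinearAlgebra.Matrix.Charpoly.Disc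
import Mathlib.Topology.Instances.Matrix
import HarnessLib

/-!
# K2 ∕ E3, (D19) FILE A — `𝔲(σ, J)` for a RANK-2 hermitian `J` in DIAGONAL COORDINATES: `𝔲(σ, ᵗ(σP)·J·P) = P⁻¹·𝔲(σ, J)·P`, the four linear coordinates of
# `𝔲(σ, diag(a₀, a₁))` over the fixed field, and `disc χ_X = ι(Λ u² − 4r b₁² + 4rΛ b₂²)` (a DIAGONAL ternary form ⊕ one dead coordinate)

Cell `pub/hodgecm-mathlib` (D-0151), Track B «K2-LIT», crux H413 = `stmt-HodgeConjecture-24833` (lane `--supports … --as helper`, count-neutral); seat K2E5-p12 (g2);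
dealer K2E3-plan (g2) deal (D19) 2026-09-04T01:53:08Z; §L line lead K2E3-p12 (g3) (head shape «=» 02:00:20Z).  THEOREMS ONLY (no definition ∕ instance ∕ notation ∕
named fact ∕ `sorry`); never imports `Cruxes/…/Lines`.  Consumer: FILE B `Theorems/K2E3U2DiscrInvFourthRootLocallyIntegrable.lean` (this seat) —
`|disc χ_Y|_{L_w}^{-1∕4} ∈ L¹_loc(𝔲₂(H_w))` at a non-split place, the `N = 2` local-integrability input of the hosted socket (L-B_U)′ `sig_K2E3UNilpotentFourierRegular`
(U12 SIGS ED. 7 :373) of the line `K2_E3_EllipticInputs`.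

THE MATHEMATICS (folklore; [PlatonovRapinchuk1994, §2.3], [Knapp2002, I §1, I §8 Example 3], [HarishChandra1999AdmissibleDistributions, §7 (rank one)]).  `E` a field with an
endomorphism `σ` (an involution where needed), `J ∈ M_n(E)`, `𝔲(σ, J) = {X | ᵗ(σX)·J + J·X = 0}` (★ `lieOfForm`).
* §1 `mem_lieOfForm_diagonal_iff` — for `J = diag(a)`: `X ∈ 𝔲 ⟺ σ(X_{kj})·a_k + a_j·X_{jk} = 0` for all `j, k`;
  `mem_lieOfForm_iff_units_conj_mem` — `X ∈ 𝔲(σ, J) ⟺ P⁻¹XP ∈ 𝔲(σ, ᵗ(σP)·J·P)` for `P ∈ GL_n(E)`; hence (`exists_addEquiv_lieOfForm_of_congr`) every additive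
  homeomorphism `𝔲(σ, ᵗ(σP)JP) ≃ M` pulls back along `X ↦ P⁻¹XP` to one of `𝔲(σ, J)`, with `χ_{P⁻¹XP} = χ_X` (Mathlib `Matrix.charpoly_units_conj'`).
* §2 quadratic coordinates `z = ι(re z) + λ·ι(im z)` of `E` over a subfield `ι : F → E` fixed by `σ`, with `σλ = −λ` (abstract package `ρ = (re, im)`: `ρ_add`, `ρ_sub`,
  skew elements have `re = 0`).
* §3 **`exists_addEquiv_lieOfForm_diagonal`** — for `a₀, a₁` fixed and non-zero, `a₁∕a₀ = ι r`, `λ² = ι Λ`: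
  `𝔲(σ, diag(a₀,a₁)) = {[[λ·ι s, −ι r·(ι b₁ − λ ι b₂)], [ι b₁ + λ ι b₂, λ·ι(s − u)]]}`, an additive homeomorphism `e : 𝔲 ≃ (Fin 3 → F) × F`, `X ↦ ((u, b₁, b₂), s)`, and
  **`disc χ_X = (X₀₀ − X₁₁)² + 4X₀₁X₁₀ = ι(Λ u² − 4r b₁² + 4rΛ b₂²)`** — the diagonal ternary form `![Λ, −4r, 4rΛ]` (all coefficients `≠ 0` when `2 ≠ 0`) in the first
  three coordinates; the fourth (`s = im X₀₀`, the centre `λ ι(F)·1`) is dead.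
HONEST LABEL: HC_CM is proved only modulo the 7 printed citations (2 remaining named inputs: hLiu418 = `stmt-HodgeConjecture-24832`, h413 = `stmt-HodgeConjecture-24833`)
until rung 0 closes; count-neutral helper.

## References
* [PlatonovRapinchuk1994] V. Platonov, A. Rapinchuk, *Algebraic Groups and Number Theory* (1994), §2.3 (unitary groups and their Lie algebras; change of form).
* [Knapp2002] A. W. Knapp, *Lie Groups Beyond an Introduction*, 2nd ed. (2002), I §1, I §8 Example 3 (`𝔲(p,q)`, `𝔰𝔲₂`).
* [HarishChandra1999AdmissibleDistributions] Harish-Chandra (DeBacker–Sally), *Admissible Invariant Distributions on Reductive p-adic Groups* (1999), §7 (rank one), Thm. 7.5.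
-/

set_option autoImplicit false
set_option linter.dupNamespace false   -- `Summit.HodgeConjecture.HodgeConjecture.…` (D-0017 nested layout; lakefile exemption for Summits)

noncomputable section

open scoped Matrix

namespace Summit.HodgeConjecture.HodgeConjecture.Cruxes.H413.K2E3U2LieDiagonalCoordinates

open Summit.HodgeConjecture.HodgeConjecture.Cruxes.H413.K2E3LieUnitary (lieOfForm mem_lieOfForm_iff)

/-! ## §1  `𝔲(σ, diag a)` entrywise, and change of form `J ↦ ᵗ(σP)·J·P` -/

section Generic

variable {R : Type*} [CommRing R] (σ : R →+* R) {n : Type*} [Fintype n] [DecidableEq n]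

/-- **`X ∈ 𝔲(σ, diag(a)) ⟺ σ(X_{kj})·a_k + a_j·X_{jk} = 0` for all `j, k`** (the `(j,k)` entry of `ᵗ(σX)·diag(a) + diag(a)·X`). [cite: PlatonovRapinchuk1994, §2.3] -/
theorem mem_lieOfForm_diagonal_iff (a : n → R) (X : Matrix n n R) :
    X ∈ lieOfForm σ (Matrix.diagonal a) ↔ ∀ j k, σ (X k j) * a k + a j * X j k = 0 := by
  rw [mem_lieOfForm_iff, ← Matrix.ext_iff]
  refine forall_congr' fun j => forall_congr' fun k => ?_
  rw [Matrix.add_apply, Matrix.mul_diagonal, Matrix.diagonal_mul, Matrix.transpose_apply, Matrix.map_apply, Matrix.zero_apply]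

/-- **Change of form: `X ∈ 𝔲(σ, J) ⟺ P⁻¹·X·P ∈ 𝔲(σ, ᵗ(σP)·J·P)`** for `P ∈ GL_n` — `ᵗ(σ(P⁻¹XP))·(ᵗ(σP)JP) + (ᵗ(σP)JP)·(P⁻¹XP) = ᵗ(σP)·(ᵗ(σX)J + JX)·P`.
[cite: PlatonovRapinchuk1994, §2.3] [cite: Knapp2002, I §1] -/
theorem mem_lieOfForm_iff_units_conj_mem (P : (Matrix n n R)ˣ) (J X : Matrix n n R) :
    X ∈ lieOfForm σ J ↔
      ((P⁻¹ : (Matrix n n R)ˣ) : Matrix n n R) * X * (P : Matrix n n R) ∈ lieOfForm σ (((P : Matrix n n R).map σ)ᵀ * J * (P : Matrix n n R)) := by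
  set A : Matrix n n R := ((P : Matrix n n R).map σ)ᵀ with hA
  set B : Matrix n n R := (((P⁻¹ : (Matrix n n R)ˣ) : Matrix n n R).map σ)ᵀ with hB
  have hBA : B * A = 1 := by
    rw [hA, hB, ← Matrix.transpose_mul, ← Matrix.map_mul, ← Units.val_mul, mul_inv_cancel, Units.val_one,
      Matrix.map_one σ (map_zero σ) (map_one σ), Matrix.transpose_one]
  have hPP : (P : Matrix n n R) * ((P⁻¹ : (Matrix n n R)ˣ) : Matrix n n R) = 1 := by
    rw [← Units.val_mul, mul_inv_cancel, Units.val_one]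
  have hPP' : ((P⁻¹ : (Matrix n n R)ˣ) : Matrix n n R) * (P : Matrix n n R) = 1 := by
    rw [← Units.val_mul, inv_mul_cancel, Units.val_one]
  have hT : ((((P⁻¹ : (Matrix n n R)ˣ) : Matrix n n R) * X * (P : Matrix n n R)).map σ)ᵀ = A * (X.map σ)ᵀ * B := by
    rw [Matrix.map_mul, Matrix.map_mul, Matrix.transpose_mul, Matrix.transpose_mul, hA, hB, Matrix.mul_assoc]
  have key : ((((P⁻¹ : (Matrix n n R)ˣ) : Matrix n n R) * X * (P : Matrix n n R)).map σ)ᵀ * (A * J * (P : Matrix n n R)) +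
      A * J * (P : Matrix n n R) * (((P⁻¹ : (Matrix n n R)ˣ) : Matrix n n R) * X * (P : Matrix n n R)) =
        A * ((X.map σ)ᵀ * J + J * X) * (P : Matrix n n R) := by
    rw [hT]
    have h1 : A * (X.map σ)ᵀ * B * (A * J * (P : Matrix n n R)) = A * ((X.map σ)ᵀ * J) * (P : Matrix n n R) := by
      calc A * (X.map σ)ᵀ * B * (A * J * (P : Matrix n n R)) = A * (X.map σ)ᵀ * (B * A) * J * (P : Matrix n n R) := by
            simp only [Matrix.mul_assoc]
        _ = A * ((X.map σ)ᵀ * J) * (P : Matrix n n R) := by rw [hBA, Matrix.mul_one]; simp only [Matrix.mul_assoc]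
    have h2 : A * J * (P : Matrix n n R) * (((P⁻¹ : (Matrix n n R)ˣ) : Matrix n n R) * X * (P : Matrix n n R)) = A * (J * X) * (P : Matrix n n R) := by
      calc A * J * (P : Matrix n n R) * (((P⁻¹ : (Matrix n n R)ˣ) : Matrix n n R) * X * (P : Matrix n n R))
          = A * J * ((P : Matrix n n R) * ((P⁻¹ : (Matrix n n R)ˣ) : Matrix n n R)) * X * (P : Matrix n n R) := by simp only [Matrix.mul_assoc]
        _ = A * (J * X) * (P : Matrix n n R) := by rw [hPP, Matrix.mul_one]; simp only [Matrix.mul_assoc]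
    rw [h1, h2, Matrix.mul_add, Matrix.add_mul]
  rw [mem_lieOfForm_iff, mem_lieOfForm_iff, key]
  constructor
  · intro h
    rw [h, Matrix.mul_zero, Matrix.zero_mul]
  · intro h
    calc (X.map σ)ᵀ * J + J * X = B * (A * ((X.map σ)ᵀ * J + J * X) * (P : Matrix n n R)) * ((P⁻¹ : (Matrix n n R)ˣ) : Matrix n n R) := by
          calc (X.map σ)ᵀ * J + J * X = (B * A) * ((X.map σ)ᵀ * J + J * X) * ((P : Matrix n n R) * ((P⁻¹ : (Matrix n n R)ˣ) : Matrix n n R)) := by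
                rw [hBA, hPP, Matrix.one_mul, Matrix.mul_one]
            _ = B * (A * ((X.map σ)ᵀ * J + J * X) * (P : Matrix n n R)) * ((P⁻¹ : (Matrix n n R)ˣ) : Matrix n n R) := by
                simp only [Matrix.mul_assoc]
      _ = 0 := by rw [h, Matrix.mul_zero, Matrix.zero_mul]

/-- **Pull-back of coordinates along a change of form.**  An additive homeomorphism `e : 𝔲(σ, ᵗ(σP)·J·P) ≃ M` yields one of `𝔲(σ, J)`, `Y ↦ e(P⁻¹YP)`, and
`χ_{P⁻¹YP} = χ_Y` (Mathlib `Matrix.charpoly_units_conj'`). [cite: PlatonovRapinchuk1994, §2.3] [cite: Knapp2002, I §1] -/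
theorem exists_addEquiv_lieOfForm_of_congr [TopologicalSpace R] [IsTopologicalRing R] {M : Type*} [AddCommGroup M] [TopologicalSpace M]
    (P : (Matrix n n R)ˣ) (J : Matrix n n R)
    (e : ↥(lieOfForm σ (((P : Matrix n n R).map σ)ᵀ * J * (P : Matrix n n R))) ≃+ M) (he : Continuous e) (hes : Continuous e.symm) :
    ∃ e' : ↥(lieOfForm σ J) ≃+ M, Continuous e' ∧ Continuous e'.symm ∧
      ∀ Y : ↥(lieOfForm σ J), ∃ X : ↥(lieOfForm σ (((P : Matrix n n R).map σ)ᵀ * J * (P : Matrix n n R))), e' Y = e X ∧ X.1.charpoly = Y.1.charpoly := by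
  have hPP : (P : Matrix n n R) * ((P⁻¹ : (Matrix n n R)ˣ) : Matrix n n R) = 1 := by
    rw [← Units.val_mul, mul_inv_cancel, Units.val_one]
  have hPP' : ((P⁻¹ : (Matrix n n R)ˣ) : Matrix n n R) * (P : Matrix n n R) = 1 := by
    rw [← Units.val_mul, inv_mul_cancel, Units.val_one]
  have hback : ∀ X : Matrix n n R, ((P⁻¹ : (Matrix n n R)ˣ) : Matrix n n R) * ((P : Matrix n n R) * X * ((P⁻¹ : (Matrix n n R)ˣ) : Matrix n n R)) * (P : Matrix n n R) = X := by
    intro X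
    calc ((P⁻¹ : (Matrix n n R)ˣ) : Matrix n n R) * ((P : Matrix n n R) * X * ((P⁻¹ : (Matrix n n R)ˣ) : Matrix n n R)) * (P : Matrix n n R)
        = (((P⁻¹ : (Matrix n n R)ˣ) : Matrix n n R) * (P : Matrix n n R)) * X * (((P⁻¹ : (Matrix n n R)ˣ) : Matrix n n R) * (P : Matrix n n R)) := by
          simp only [Matrix.mul_assoc]
      _ = X := by rw [hPP', Matrix.one_mul, Matrix.mul_one]
  have hforth : ∀ Y : Matrix n n R, (P : Matrix n n R) * (((P⁻¹ : (Matrix n n R)ˣ) : Matrix n n R) * Y * (P : Matrix n n R)) * ((P⁻¹ : (Matrix n n R)ˣ) : Matrix n n R) = Y := by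
    intro Y
    calc (P : Matrix n n R) * (((P⁻¹ : (Matrix n n R)ˣ) : Matrix n n R) * Y * (P : Matrix n n R)) * ((P⁻¹ : (Matrix n n R)ˣ) : Matrix n n R)
        = ((P : Matrix n n R) * ((P⁻¹ : (Matrix n n R)ˣ) : Matrix n n R)) * Y * ((P : Matrix n n R) * ((P⁻¹ : (Matrix n n R)ˣ) : Matrix n n R)) := by
          simp only [Matrix.mul_assoc]
      _ = Y := by rw [hPP, Matrix.one_mul, Matrix.mul_one]
  let κ : ↥(lieOfForm σ J) ≃+ ↥(lieOfForm σ (((P : Matrix n n R).map σ)ᵀ * J * (P : Matrix n n R))) :=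
    { toFun := fun Y => ⟨((P⁻¹ : (Matrix n n R)ˣ) : Matrix n n R) * Y.1 * (P : Matrix n n R), (mem_lieOfForm_iff_units_conj_mem σ P J Y.1).1 Y.2⟩
      invFun := fun X => ⟨(P : Matrix n n R) * X.1 * ((P⁻¹ : (Matrix n n R)ˣ) : Matrix n n R), by
        rw [mem_lieOfForm_iff_units_conj_mem σ P J, hback]
        exact X.2⟩
      left_inv := fun Y => Subtype.ext (hforth Y.1)
      right_inv := fun X => Subtype.ext (hback X.1)
      map_add' := fun Y Z => Subtype.ext (by
        show ((P⁻¹ : (Matrix n n R)ˣ) : Matrix n n R) * (Y.1 + Z.1) * (P : Matrix n n R) =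
          ((P⁻¹ : (Matrix n n R)ˣ) : Matrix n n R) * Y.1 * (P : Matrix n n R) + ((P⁻¹ : (Matrix n n R)ˣ) : Matrix n n R) * Z.1 * (P : Matrix n n R)
        rw [Matrix.mul_add, Matrix.add_mul]) }
  have hκ : Continuous κ := continuous_induced_rng.2 <|
    show Continuous (fun Y : ↥(lieOfForm σ J) => ((P⁻¹ : (Matrix n n R)ˣ) : Matrix n n R) * Y.1 * (P : Matrix n n R)) from
      (continuous_const.mul continuous_subtype_val).mul continuous_const
  have hκs : Continuous κ.symm := continuous_induced_rng.2 <|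
    show Continuous (fun X : ↥(lieOfForm σ (((P : Matrix n n R).map σ)ᵀ * J * (P : Matrix n n R))) =>
        (P : Matrix n n R) * X.1 * ((P⁻¹ : (Matrix n n R)ˣ) : Matrix n n R)) from
      (continuous_const.mul continuous_subtype_val).mul continuous_const
  refine ⟨κ.trans e, he.comp hκ, hκs.comp hes, fun Y => ⟨κ Y, rfl, ?_⟩⟩
  show (((P⁻¹ : (Matrix n n R)ˣ) : Matrix n n R) * Y.1 * (P : Matrix n n R)).charpoly = Y.1.charpoly
  rw [Matrix.coe_units_inv]
  exact Matrix.charpoly_units_conj' P Y.1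

end Generic

/-! ## §2  Quadratic coordinates `z = ι(re z) + λ·ι(im z)` over a `σ`-fixed subfield (abstract package) -/

section Coordinates

variable {F E : Type*} [Field F] [Field E] (σ : E →+* E) (ι : F →+* E) (lam : E) (ρ : E → F × F)
  (hρ1 : ∀ z, ι (ρ z).1 + lam * ι (ρ z).2 = z) (hρ2 : ∀ r i, ρ (ι r + lam * ι i) = (r, i))
  (hσι : ∀ r, σ (ι r) = ι r) (hσl : σ lam = -lam) (h2 : (2 : E) ≠ 0)

include hρ1 hρ2 in
/-- `ρ = (re, im)` is additive (it inverts the additive map `(r, i) ↦ ι r + λ ι i`). [cite: PlatonovRapinchuk1994, §2.3] -/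
theorem ρ_add (z z' : E) : ρ (z + z') = ρ z + ρ z' := by
  have h : z + z' = ι ((ρ z).1 + (ρ z').1) + lam * ι ((ρ z).2 + (ρ z').2) := by
    conv_lhs => rw [← hρ1 z, ← hρ1 z']
    rw [map_add, map_add]
    ring
  rw [h, hρ2]
  rfl

include hρ1 hρ2 in
/-- `ρ (z − z') = ρ z − ρ z'`. [cite: PlatonovRapinchuk1994, §2.3] -/
theorem ρ_sub (z z' : E) : ρ (z - z') = ρ z - ρ z' := by
  have h : z - z' = ι ((ρ z).1 - (ρ z').1) + lam * ι ((ρ z).2 - (ρ z').2) := by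
    conv_lhs => rw [← hρ1 z, ← hρ1 z']
    rw [map_sub, map_sub]
    ring
  rw [h, hρ2]
  rfl

include hρ1 hσι hσl in
/-- `σ z = ι(re z) − λ·ι(im z)`. [cite: PlatonovRapinchuk1994, §2.3] -/
theorem σ_eq_sub (z : E) : σ z = ι (ρ z).1 - lam * ι (ρ z).2 := by
  conv_lhs => rw [← hρ1 z]
  rw [map_add, map_mul, hσι, hσι, hσl]
  ring

include hρ1 hσι hσl h2 in
/-- A SKEW element (`σ z = −z`) has `re z = 0` (`2·ι(re z) = 0`, `2 ≠ 0`, `ι` injective). [cite: PlatonovRapinchuk1994, §2.3] -/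
theorem ρ_fst_eq_zero_of_skew {z : E} (hz : σ z = -z) : (ρ z).1 = 0 := by
  have h := σ_eq_sub σ ι lam ρ hρ1 hσι hσl z
  rw [hz] at h
  have hz1 := hρ1 z
  have h' : (2 : E) * ι (ρ z).1 = 0 := by linear_combination hz1 - h
  exact (map_eq_zero_iff ι ι.injective).1 ((mul_eq_zero.1 h').resolve_left h2)

include hρ1 hσι hσl h2 in
/-- A skew element is `λ·ι(im z)`. [cite: PlatonovRapinchuk1994, §2.3] -/
theorem eq_lam_mul_of_skew {z : E} (hz : σ z = -z) : z = lam * ι (ρ z).2 := by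
  conv_lhs => rw [← hρ1 z]
  rw [ρ_fst_eq_zero_of_skew σ ι lam ρ hρ1 hσι hσl h2 hz, map_zero, zero_add]

end Coordinates

/-! ## §3  `𝔲(σ, diag(a₀, a₁))` in coordinates and `disc χ_X = ι(Λ u² − 4r b₁² + 4rΛ b₂²)` -/

section Diagonal

variable {F E : Type*} [Field F] [Field E] [TopologicalSpace F] [TopologicalSpace E] [IsTopologicalRing E]
  (σ : E →+* E) (ι : F →+* E) (hι : Continuous ι) (lam : E) (ρ : E → F × F) (hρc : Continuous ρ)
  (hρ1 : ∀ z, ι (ρ z).1 + lam * ι (ρ z).2 = z) (hρ2 : ∀ r i, ρ (ι r + lam * ι i) = (r, i))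
  (hσι : ∀ r, σ (ι r) = ι r) (hσl : σ lam = -lam) (h2 : (2 : E) ≠ 0)

include hι hρc hρ1 hρ2 hσι hσl h2 in
/-- **`𝔲(σ, diag(a₀, a₁))` IN COORDINATES AND ITS DISCRIMINANT.**  For `a_i ≠ 0` with `a₁∕a₀ = ι r` (so `σ` fixes `a₁∕a₀`), `λ² = ι Λ`: an additive homeomorphism
`e : 𝔲(σ, diag(a₀,a₁)) ≃ (Fin 3 → F) × F`, `X ↦ ((im(X₀₀ − X₁₁), re X₁₀, im X₁₀), im X₀₀)`, inverse
`((u,b₁,b₂), s) ↦ [[λ ι s, −ι r (ι b₁ − λ ι b₂)], [ι b₁ + λ ι b₂, λ ι(s − u)]]`, with **`disc χ_X = ι(Λ u² − 4r b₁² + 4rΛ b₂²)`**.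
[cite: Knapp2002, I §8 Example 3] [cite: HarishChandra1999AdmissibleDistributions, Thm. 7.5 p. 51 (rank one)] [cite: PlatonovRapinchuk1994, §2.3] -/
theorem exists_addEquiv_lieOfForm_diagonal (a : Fin 2 → E) (ha0 : ∀ i, a i ≠ 0) (r d : F) (hr : ι r = a 1 / a 0) (hd : lam * lam = ι d) :
    ∃ e : ↥(lieOfForm σ (Matrix.diagonal a)) ≃+ ((Fin 3 → F) × F), Continuous e ∧ Continuous e.symm ∧
      ∀ X : ↥(lieOfForm σ (Matrix.diagonal a)), X.1.charpoly.discr = ι (∑ i : Fin 3, (![d, -4 * r, 4 * r * d] i) * (e X).1 i ^ 2) := by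
  have har : a 0 * ι r = a 1 := by rw [hr]; have := ha0 0; field_simp
  -- the inverse chart
  let g : ((Fin 3 → F) × F) → Matrix (Fin 2) (Fin 2) E := fun p =>
    !![lam * ι p.2, -(ι r) * (ι (p.1 1) - lam * ι (p.1 2)); ι (p.1 1) + lam * ι (p.1 2), lam * (ι p.2 - ι (p.1 0))]
  have hg00 : ∀ p, g p 0 0 = lam * ι p.2 := fun p => rfl
  have hg01 : ∀ p, g p 0 1 = -(ι r) * (ι (p.1 1) - lam * ι (p.1 2)) := fun p => rfl
  have hg10 : ∀ p, g p 1 0 = ι (p.1 1) + lam * ι (p.1 2) := fun p => rfl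
  have hg11 : ∀ p, g p 1 1 = lam * (ι p.2 - ι (p.1 0)) := fun p => rfl
  have hgmem : ∀ p, g p ∈ lieOfForm σ (Matrix.diagonal a) := by
    intro p
    rw [mem_lieOfForm_diagonal_iff]
    intro j k
    fin_cases j <;> fin_cases k
    · show σ (g p 0 0) * a 0 + a 0 * g p 0 0 = 0
      rw [hg00, map_mul, hσl, hσι]; ring
    · show σ (g p 1 0) * a 1 + a 0 * g p 0 1 = 0
      rw [hg10, hg01, map_add, map_mul, hσι, hσι, hσl]; linear_combination (-(ι (p.1 1)) + lam * ι (p.1 2)) * har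
    · show σ (g p 0 1) * a 0 + a 1 * g p 1 0 = 0
      rw [hg01, hg10, map_mul, map_neg, map_sub, map_mul, hσι, hσι, hσι, hσl]; linear_combination (-(ι (p.1 1)) - lam * ι (p.1 2)) * har
    · show σ (g p 1 1) * a 1 + a 1 * g p 1 1 = 0
      rw [hg11, map_mul, map_sub, hσl, hσι, hσι]; ring
  -- the chart
  let f : Matrix (Fin 2) (Fin 2) E → ((Fin 3 → F) × F) := fun X => (![(ρ (X 0 0 - X 1 1)).2, (ρ (X 1 0)).1, (ρ (X 1 0)).2], (ρ (X 0 0)).2)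
  have hf0 : ∀ X, (f X).1 0 = (ρ (X 0 0 - X 1 1)).2 := fun X => rfl
  have hf1 : ∀ X, (f X).1 1 = (ρ (X 1 0)).1 := fun X => rfl
  have hf2 : ∀ X, (f X).1 2 = (ρ (X 1 0)).2 := fun X => rfl
  have hfs : ∀ X, (f X).2 = (ρ (X 0 0)).2 := fun X => rfl
  have hfg : ∀ p, f (g p) = p := by
    intro p
    have h1 : g p 0 0 - g p 1 1 = ι 0 + lam * ι (p.1 0) := by rw [hg00, hg11, map_zero]; ring
    have h2' : g p 0 0 = ι 0 + lam * ι p.2 := by rw [hg00, map_zero, zero_add]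
    refine Prod.ext (funext fun i => ?_) ?_
    · fin_cases i
      · show (f (g p)).1 0 = p.1 0
        rw [hf0, h1, hρ2]
      · show (f (g p)).1 1 = p.1 1
        rw [hf1, hg10, hρ2]
      · show (f (g p)).1 2 = p.1 2
        rw [hf2, hg10, hρ2]
    · show (f (g p)).2 = p.2
      rw [hfs, h2', hρ2]
  have hgf : ∀ X : ↥(lieOfForm σ (Matrix.diagonal a)), g (f X.1) = X.1 := by
    intro X
    have hX := (mem_lieOfForm_diagonal_iff σ a X.1).1 X.2
    have hsk0 : σ (X.1 0 0) = -X.1 0 0 := by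
      have h := hX 0 0
      have h' : a 0 * (σ (X.1 0 0) + X.1 0 0) = 0 := by linear_combination h
      exact eq_neg_of_add_eq_zero_left ((mul_eq_zero.1 h').resolve_left (ha0 0))
    have hsk1 : σ (X.1 1 1) = -X.1 1 1 := by
      have h := hX 1 1
      have h' : a 1 * (σ (X.1 1 1) + X.1 1 1) = 0 := by linear_combination h
      exact eq_neg_of_add_eq_zero_left ((mul_eq_zero.1 h').resolve_left (ha0 1))
    have h01 : X.1 0 1 = -(ι r) * σ (X.1 1 0) := by
      have h := hX 0 1
      have h' : a 0 * (X.1 0 1 + ι r * σ (X.1 1 0)) = 0 := by linear_combination h + σ (X.1 1 0) * har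
      rw [neg_mul]
      exact eq_neg_of_add_eq_zero_left ((mul_eq_zero.1 h').resolve_left (ha0 0))
    ext i j
    fin_cases i <;> fin_cases j
    · show g (f X.1) 0 0 = X.1 0 0
      rw [hg00, hfs]
      exact (eq_lam_mul_of_skew σ ι lam ρ hρ1 hσι hσl h2 hsk0).symm
    · show g (f X.1) 0 1 = X.1 0 1
      rw [hg01, hf1, hf2, h01, σ_eq_sub σ ι lam ρ hρ1 hσι hσl (X.1 1 0)]
    · show g (f X.1) 1 0 = X.1 1 0
      rw [hg10, hf1, hf2]
      exact hρ1 _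
    · show g (f X.1) 1 1 = X.1 1 1
      rw [hg11, hfs, hf0, ρ_sub ι lam ρ hρ1 hρ2, Prod.snd_sub, map_sub, sub_sub_cancel]
      exact (eq_lam_mul_of_skew σ ι lam ρ hρ1 hσι hσl h2 hsk1).symm
  let e' : ((Fin 3 → F) × F) ≃+ ↥(lieOfForm σ (Matrix.diagonal a)) :=
    { toFun := fun p => ⟨g p, hgmem p⟩
      invFun := fun X => f X.1
      left_inv := fun p => hfg p
      right_inv := fun X => Subtype.ext (hgf X)
      map_add' := fun p q => Subtype.ext (by
        show g (p + q) = g p + g q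
        ext i j
        fin_cases i <;> fin_cases j
        · show g (p + q) 0 0 = g p 0 0 + g q 0 0
          simp only [hg00, Prod.snd_add, map_add]; ring
        · show g (p + q) 0 1 = g p 0 1 + g q 0 1
          simp only [hg01, Prod.fst_add, Pi.add_apply, map_add]; ring
        · show g (p + q) 1 0 = g p 1 0 + g q 1 0
          simp only [hg10, Prod.fst_add, Pi.add_apply, map_add]; ring
        · show g (p + q) 1 1 = g p 1 1 + g q 1 1
          simp only [hg11, Prod.fst_add, Prod.snd_add, Pi.add_apply, map_add]; ring) }
  -- continuity
  have hgc : Continuous g := by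
    have hz : ∀ i : Fin 3, Continuous fun p : (Fin 3 → F) × F => ι (p.1 i) := fun i => hι.comp ((continuous_apply i).comp continuous_fst)
    have hs : Continuous fun p : (Fin 3 → F) × F => ι p.2 := hι.comp continuous_snd
    refine continuous_matrix fun i j => ?_
    fin_cases i <;> fin_cases j
    · exact continuous_const.mul hs
    · exact continuous_const.mul ((hz 1).sub (continuous_const.mul (hz 2)))
    · exact (hz 1).add (continuous_const.mul (hz 2))
    · exact continuous_const.mul (hs.sub (hz 0))
  have hfc : Continuous fun X : ↥(lieOfForm σ (Matrix.diagonal a)) => f X.1 := by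
    have hv : Continuous fun X : ↥(lieOfForm σ (Matrix.diagonal a)) => (X.1 : Matrix (Fin 2) (Fin 2) E) := continuous_subtype_val
    have hu : Continuous fun X : ↥(lieOfForm σ (Matrix.diagonal a)) => ρ (X.1 0 0 - X.1 1 1) := hρc.comp ((hv.matrix_elem 0 0).sub (hv.matrix_elem 1 1))
    have hb : Continuous fun X : ↥(lieOfForm σ (Matrix.diagonal a)) => ρ (X.1 1 0) := hρc.comp (hv.matrix_elem 1 0)
    have hs : Continuous fun X : ↥(lieOfForm σ (Matrix.diagonal a)) => ρ (X.1 0 0) := hρc.comp (hv.matrix_elem 0 0)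
    refine continuous_prodMk.2 ⟨continuous_pi fun i => ?_, continuous_snd.comp hs⟩
    fin_cases i
    · exact continuous_snd.comp hu
    · exact continuous_fst.comp hb
    · exact continuous_snd.comp hb
  refine ⟨e'.symm, hfc, hgc.subtype_mk _, fun X => ?_⟩
  -- the discriminant in coordinates
  have hX : X.1 = g (f X.1) := (hgf X).symm
  set p := f X.1 with hp
  show X.1.charpoly.discr = ι (∑ i : Fin 3, (![d, -4 * r, 4 * r * d] i) * p.1 i ^ 2)
  have hdisc : (g p).charpoly.discr = (g p).trace ^ 2 - 4 * (g p).det := Matrix.discr_fin_two (g p)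
  rw [hX, hdisc, Matrix.trace_fin_two, Matrix.det_fin_two, hg00, hg01, hg10, hg11, Fin.sum_univ_three]
  simp only [Matrix.cons_val_zero, Matrix.cons_val_one, Matrix.cons_val_two, Matrix.head_cons, Matrix.tail_cons, map_add, map_mul,
    map_pow, map_neg, map_ofNat]
  linear_combination (ι (p.1 0) ^ 2 + 4 * ι r * ι (p.1 2) ^ 2) * hd

end Diagonal

end Summit.HodgeConjecture.HodgeConjecture.Cruxes.H413.K2E3U2LieDiagonalCoordinates

end
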